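import Summits.FinalStateConjecture.FinalStateConjecture.Theorems.ClusterCompletenessOmegaLimitMultiKerrDefs
import Summits.FinalStateConjecture.FinalStateConjecture.Theorems.ClusterCompletenessLinearToNonlinearCaptureStubIsOpenSubsetChronologicalPast
import HarnessLib

/-!
# Crux `ClusterCompleteness.OmegaLimitMultiKerr` (stmt-FinalStateConjecture-14664), line `Sketch` —
# restarting the recur interface at a later chart time

Support lemma of the line lead (gen 2) over the landed vocabulary `Recurs k` of
`ClusterCompletenessOmegaLimitMultiKerrDefs`:

* `recurs_restart` — **"WLOG `τ₀` is large"**: if `𝒟` recurs at order `k`, then for every `T` it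
  recurs at order `k` with a late time `τ₀ ≥ T` and the SAME labels, motions, charts, excision and
  exhaustion radii and flat domain (the conclusion is the body of `Recurs k 𝒟` verbatim with the
  extra conjunct `T ≤ τ₀`). Restart all charts at `τ₀' := max T τ₀` and take the exterior region
  `O' := J⁺(Σ) ∩ I⁻(C')` of the restarted charted set `C' ⊆ C`: the restarted (open) charted set
  lies in its own chronological past (`stub_isOpen_subset_chronologicalPast`), `O' ⊆ O`, so
  exhaustion, the anchor and recurrence are inherited, and the remaining clauses only weaken.

This is the bookkeeping every line uses before re-basing or comparing charts at late times
(cards `select-and-rebase`, `wandering-labels-recentring`). Everything is proved; Mathlib + landed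
`Theorems` files only (pattern of `recurs_of_finalStateDecomposition`).
-/

-- every `Summit.FinalStateConjecture.FinalStateConjecture.…` name repeats the summit = sub-problem segment (D-0017 layout)
set_option linter.dupNamespace false

noncomputable section

open scoped Manifold ContDiff Topology ENNReal
open Set Filter TopologicalSpace

namespace Summit.FinalStateConjecture.FinalStateConjecture.Theorems.ClusterCompleteness

open Literature.Geometry.Lorentzian

universe u

/-- Restarting a late chart at a later time, into any region containing the image of the later
(open) late region. [folklore] -/
private theorem isLateChart_restart' {𝓢 : Spacetime.{u} 4} {B : ModelBackground}
    {O O' : Set 𝓢.carrier} {τ₀ τ₁ : ℝ} {Ψ : B.domain → 𝓢.carrier}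
    (h : 𝓢.IsLateChart B O τ₀ Ψ) (hτ : τ₀ ≤ τ₁) (hopen : IsOpen (B.lateRegion τ₁))
    (hO' : Ψ '' B.lateRegion τ₁ ⊆ O') : 𝓢.IsLateChart B O' τ₁ Ψ where
  contMDiff := h.contMDiff
  isOpenEmbedding := h.isOpenEmbedding.comp
    (Topology.IsOpenEmbedding.inclusion (B.lateRegion_mono hτ)
      (hopen.preimage continuous_subtype_val))
  image_subset := hO'

/-- The image of a later (open) late region under a late chart is open. [folklore] -/
private theorem isOpen_image_lateRegion' {𝓢 : Spacetime.{u} 4} {B : ModelBackground}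
    {O : Set 𝓢.carrier} {τ₀ τ₁ : ℝ} {Ψ : B.domain → 𝓢.carrier}
    (h : 𝓢.IsLateChart B O τ₀ Ψ) (hτ : τ₀ ≤ τ₁) (hopen : IsOpen (B.lateRegion τ₁)) :
    IsOpen (Ψ '' B.lateRegion τ₁) := by
  rw [← range_restrict]
  exact (h.isOpenEmbedding.comp (Topology.IsOpenEmbedding.inclusion (B.lateRegion_mono hτ)
    (hopen.preimage continuous_subtype_val))).isOpen_range

/-- **Restarting the recur interface at a later chart time** ("WLOG `τ₀ ≥ T`"). If the vacuum
Cauchy development `𝒟` recurs at order `k`, then for every `T` the body of `Recurs k 𝒟` holds with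
a late time `τ₀ ≥ T` — with the same labels, motions, charts, excision radii, exhaustion radii and
flat domain, the charts restarted at `max T τ₀` and the region replaced by the exterior region of
the restarted charted set. [folklore] -/
theorem recurs_restart : ∀ {X : Type} [TopologicalSpace X] [ChartedSpace E3 X]
    [IsManifold (𝓡 3) ∞ X] [ConnectedSpace X] {D : InitialDataSet (𝓡 3) X}
    (𝒟 : VacuumCauchyDevelopment D) {k : ℕ}, Recurs k 𝒟 → ∀ T : ℝ,
    ∃ (O : Set 𝒟.carrier) (N : ℕ) (M a : Fin N → ℝ) (mo : Fin N → lorentzGroup × E4) (τ₀ : ℝ)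
      (Ψ : ∀ i, boostedKerrExterior (mo i).1 (mo i).2 (M i) (a i) → 𝒟.carrier)
      (ρ R : Fin N → ℝ → ℝ) (U₀ : Opens E4) (Ψ₀ : U₀ → 𝒟.carrier),
      T ≤ τ₀ ∧
      (∀ i, Kerr.IsSubextremal (M i) (a i)) ∧
      (∀ i, 𝒟.toSpacetime.IsLateChart (boostedKerrBackground (mo i).1 (mo i).2 (M i) (a i)) O τ₀
        (Ψ i)) ∧
      𝒟.toSpacetime.IsLateChart (Minkowski.backgroundOn U₀) O τ₀ Ψ₀ ∧
      (∀ i, Tendsto (fun t ↦ ρ i t / t) atTop (𝓝 0)) ∧ (∀ i, Tendsto (R i) atTop atTop) ∧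
      {x : E4 | τ₀ < x 0 ∧ ∀ i, ρ i (x 0) <
        Kerr.radius (a i) (poincareInv (mo i).1 (mo i).2 x)} ⊆ (U₀ : Set E4) ∧
      (∀ R' : ℝ, ∃ τ₁ : ℝ, Pairwise (Function.onFun Disjoint fun i ↦ Ψ i ''
        (boostedKerrBackground (mo i).1 (mo i).2 (M i) (a i)).truncLateRegion τ₁ R')) ∧
      O = Summit.FinalStateConjecture.exteriorOf 𝒟.toCauchyDevelopment
        ((⋃ i, Ψ i '' (boostedKerrBackground (mo i).1 (mo i).2 (M i) (a i)).lateRegion τ₀) ∪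
          Ψ₀ '' (Minkowski.backgroundOn U₀).lateRegion τ₀) ∧
      (∀ τ₁ : ℝ, τ₀ < τ₁ → O \ (Ψ₀ '' (Minkowski.backgroundOn U₀).lateRegion τ₁ ∪
        ⋃ i, Ψ i '' {x | τ₁ < (boostedKerrBackground (mo i).1 (mo i).2 (M i) (a i)).time x.1 ∧
          (boostedKerrBackground (mo i).1 (mo i).2 (M i) (a i)).radius x.1 ≤
            R i ((boostedKerrBackground (mo i).1 (mo i).2 (M i) (a i)).time x.1)}) ⊆
        𝒟.metric.causalPast 𝒟.timeOrientation (Ψ₀ '' (Minkowski.backgroundOn U₀).timeSlab τ₁ ∪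
          ⋃ i, Ψ i '' (boostedKerrBackground (mo i).1 (mo i).2 (M i) (a i)).truncTimeSlab
            (R i τ₁) τ₁)) ∧
      (∀ τ : ℝ, τ₀ < τ →
        𝒟.toSpacetime.deviationCk (Minkowski.backgroundOn U₀) Ψ₀ 0 τ ≤ ENNReal.ofReal (1 / 4) ∧
        ∀ i, 𝒟.toSpacetime.truncDeviationCk (boostedKerrBackground (mo i).1 (mo i).2 (M i) (a i))
          (Ψ i) 0 (R i τ) τ ≤ ENNReal.ofReal (1 / 4)) ∧
      ∀ R' : ℝ, ∀ ε : ℝ, 0 < ε → ∃ᶠ τ in atTop,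
        𝒟.toSpacetime.deviationCk (Minkowski.backgroundOn U₀) Ψ₀ k τ ≤ ENNReal.ofReal ε ∧
        ∀ i, 𝒟.toSpacetime.truncDeviationCk (boostedKerrBackground (mo i).1 (mo i).2 (M i) (a i))
          (Ψ i) k R' τ ≤ ENNReal.ofReal ε := by
  intro X _ _ _ _ D 𝒟 k h T
  obtain ⟨O, N, M, a, mo, τ₀, Ψ, ρ, R, U₀, Ψ₀, h₁, h₂, h₃, h₄, h₅, h₆, h₇, h₈, h₉, h₁₀, h₁₁⟩ := h
  set τ₀' : ℝ := max T τ₀ with hτ₀'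
  have hT : T ≤ τ₀' := le_max_left _ _
  have h0' : τ₀ ≤ τ₀' := le_max_right _ _
  -- continuity of the chart times, openness of the late regions
  have hcK : ∀ i, Continuous (boostedKerrBackground (mo i).1 (mo i).2 (M i) (a i)).time :=
    fun i ↦ (PiLp.continuous_apply 2 _ 0).comp (continuous_poincareInv _ _)
  have hc0 : Continuous (Minkowski.backgroundOn U₀).time := PiLp.continuous_apply 2 _ 0
  have hoK : ∀ i (τ : ℝ),
      IsOpen ((boostedKerrBackground (mo i).1 (mo i).2 (M i) (a i)).lateRegion τ) :=
    fun i τ ↦ isOpen_lt continuous_const ((hcK i).comp continuous_subtype_val)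
  have ho0 : ∀ τ : ℝ, IsOpen ((Minkowski.backgroundOn U₀).lateRegion τ) :=
    fun τ ↦ isOpen_lt continuous_const (hc0.comp continuous_subtype_val)
  -- the restarted charted set `C'`: open, inside the old one, inside its own exterior region
  set C' : Set 𝒟.carrier := (⋃ i, Ψ i '' (boostedKerrBackground (mo i).1 (mo i).2 (M i)
      (a i)).lateRegion τ₀') ∪ Ψ₀ '' (Minkowski.backgroundOn U₀).lateRegion τ₀' with hC'
  have hC'open : IsOpen C' :=
    (isOpen_iUnion fun i ↦ isOpen_image_lateRegion' (h₂ i) h0' (hoK i _)).union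
      (isOpen_image_lateRegion' h₃ h0' (ho0 _))
  have hC'sub : C' ⊆ (⋃ i, Ψ i '' (boostedKerrBackground (mo i).1 (mo i).2 (M i)
      (a i)).lateRegion τ₀) ∪ Ψ₀ '' (Minkowski.backgroundOn U₀).lateRegion τ₀ :=
    union_subset_union (iUnion_mono fun i ↦ image_mono
      ((boostedKerrBackground (mo i).1 (mo i).2 (M i) (a i)).lateRegion_mono h0'))
      (image_mono ((Minkowski.backgroundOn U₀).lateRegion_mono h0'))
  have hC'O : C' ⊆ O := by
    rintro p (hp | hp)
    · obtain ⟨i, hp⟩ := mem_iUnion.mp hp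
      exact (h₂ i).image_subset (image_mono
        ((boostedKerrBackground (mo i).1 (mo i).2 (M i) (a i)).lateRegion_mono h0') hp)
    · exact h₃.image_subset (image_mono ((Minkowski.backgroundOn U₀).lateRegion_mono h0') hp)
  have hOJ : O ⊆ 𝒟.metric.causalFuture 𝒟.timeOrientation (range 𝒟.embed) := by
    rw [h₈]; exact fun p hp ↦ hp.1
  set O' : Set 𝒟.carrier := Summit.FinalStateConjecture.exteriorOf 𝒟.toCauchyDevelopment C'
    with hO'def
  have hC'O' : C' ⊆ O' :=
    subset_inter (hC'O.trans hOJ) (stub_isOpen_subset_chronologicalPast _ hC'open)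
  have hO'O : O' ⊆ O := fun p hp ↦
    h₈ ▸ (⟨hp.1, LorentzianMetric.chronologicalFuture_mono (τ := 𝒟.timeOrientation.reverse)
      hC'sub hp.2⟩ : p ∈ Summit.FinalStateConjecture.exteriorOf 𝒟.toCauchyDevelopment _)
  refine ⟨O', N, M, a, mo, τ₀', Ψ, ρ, R, U₀, Ψ₀, hT, h₁, fun i ↦ ?_, ?_, h₄, h₅, ?_, h₇, rfl,
    fun τ₁ hτ₁ ↦ ?_, fun τ hτ ↦ h₁₀ τ (h0'.trans_lt hτ), h₁₁⟩
  · -- hole charts, restarted at `τ₀'`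
    exact isLateChart_restart' (h₂ i) h0' (hoK i _)
      ((subset_iUnion (fun i ↦ Ψ i '' (boostedKerrBackground (mo i).1 (mo i).2 (M i)
        (a i)).lateRegion τ₀') i).trans (subset_union_left.trans hC'O'))
  · -- flat chart, restarted at `τ₀'`
    exact isLateChart_restart' h₃ h0' (ho0 _) (subset_union_right.trans hC'O')
  · -- the flat domain contains the later half-space minus the excised tubes
    exact fun x hx ↦ h₆ ⟨h0'.trans_lt hx.1, hx.2⟩
  · -- exhaustion of `O' ⊆ O` at `τ₁ > τ₀' ≥ τ₀`
    exact fun p hp ↦ h₉ τ₁ (h0'.trans_lt hτ₁) ⟨hO'O hp.1, hp.2⟩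

end Summit.FinalStateConjecture.FinalStateConjecture.Theorems.ClusterCompleteness

end
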